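import Literature.Analysis.OperatorTheory.DeflatedFormBound
import HarnessLib

/-!
# Route `LuscherReduction`, item `DressedRitz` (stmt-QuantumFields-20205) — reduction chain, file A:
# generic Rayleigh–Ritz algebra — LEMMA A (residual Gram form of a Ritz basis from per-generator residuals) and the arithmetic
# core of LEMMA B (quadratic forms with near-diagonal data)

Support module of the `FemtoTransferGap` group (fleet service by seat ym-infvol-p2 g6; route `LuscherReduction`, femto rung R2b1; bears on the
crux child `DressedRitz` = stmt-QuantumFields-20205 of RED `RunningReduction` stmt-QuantumFields-19978).  CONTENT = §0 and §5 of the planner's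
crux workfile `Summits/QuantumFields/YangMills/Cruxes/RunningReduction/Lines/DressedRitzGEVP.lean` (rev 3, sha16 8eae6de8b30412fb, seat
ym-cruxidea-19978-1 GEN 4–5; kernel-checked there, farm rc 0) RE-HOMED VERBATIM on the Theorems side (proofs unchanged; namespace
`…Theorems.FemtoTransferGap.KTGen` instead of `…Cruxes.RunningReduction.KTGen`), because Cruxes workfiles are not importable on the farm and the
closing file of item 20205 must live under `Theorems/`.  Generic, operator-free linear algebra — nothing here is specific to gauge theory:

* `two_mul_bilin_le`, `bilin_sum_self_le` — `2 ip(a,b) ≤ ip(a,a) + ip(b,b)`, `ip(Σ y_l, Σ y_l) ≤ n Σ ip(y_l, y_l)` for a positive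
  semidefinite symmetric form on a real vector space.
* **LEMMA A** `residualGram_le_of_generators`: generators `v` with Gram conditioning `g Σ b_l² ≤ ip(Σ b_l v_l, Σ b_l v_l)` and per-generator
  residuals `ip((K − d_l)v_l,(K − d_l)v_l) ≤ ρ`; `u` an `ip`-orthonormal `K`-diagonal basis of the same span; then the residual Gram form of
  `u` is `≤ (nρ/g) Σ c_i²` (the span residual is the `ip`-shortest vector `Kψ − x`, `x ∈ span`).
* **LEMMA B core** (`ι`-indexed, pure real): `quadForm_sub_diag_abs_le` (a quadratic form with `|G − 1| ≤ ε` and symmetrised couplings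
  `|A_il − ½(d_i+d_l)G_il| ≤ τ` differs from its diagonal model by `≤ τB² + εB Σ|d_i − t||b_i|`), `quadForm_lower_of_nonneg`,
  `quadForm_upper_of_constraints` (both second order in `ε`), `gram_lower`, `abs_coeff_le_of_constraint`, `sq_sum_abs_le_card_mul_sum_sq`.

File B (`…DressedRitzRitzNearDiagonal.lean`): LEMMA B proper.  HONEST FRAMING: fixed-lattice ∕ linear-algebra bookkeeping for the femto rung
R2b1; proves nothing OF `DressedRitz` (the XL estimate); no bearing on infinite volume, the continuum limit or the Clay gap.
References: Golub–Van Loan §8.1 [cite: GolubVanLoan2013, §8.1.1]; Lüscher–Wolff, NPB 339 (1990) 222 (GEVP) [cite: LuscherWolff1990];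
Reed–Simon IV XIII.1–2 [cite: ReedSimonIV1978, XIII.1].
-/

set_option autoImplicit false

noncomputable section

open scoped BigOperators

namespace Summit.QuantumFields.YangMills.Theorems.FemtoTransferGap.KTGen

open Literature.Analysis.OperatorTheory

/-! ## §0 LEMMA A (operator-free): the residual Gram form of a Ritz basis from per-generator residuals -/

section Generators

variable {D : Type*} [AddCommGroup D] [Module ℝ D]

/-- `2·ip(a,b) ≤ ip(a,a) + ip(b,b)` for a positive semidefinite symmetric form. [folklore] -/
theorem two_mul_bilin_le (ip : D →ₗ[ℝ] D →ₗ[ℝ] ℝ) (hsymm : ∀ x y, ip x y = ip y x) (hpos : ∀ x, 0 ≤ ip x x)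
    (a b : D) : 2 * ip a b ≤ ip a a + ip b b := by
  have h := hpos (a - b)
  simp only [map_sub, LinearMap.sub_apply] at h
  rw [hsymm b a] at h
  linarith

/-- `ip(Σ_l y_l, Σ_l y_l) ≤ n · Σ_l ip(y_l, y_l)` (`n` terms) for a positive semidefinite symmetric form. [folklore] -/
theorem bilin_sum_self_le (ip : D →ₗ[ℝ] D →ₗ[ℝ] ℝ) (hsymm : ∀ x y, ip x y = ip y x) (hpos : ∀ x, 0 ≤ ip x x)
    {n : ℕ} (y : Fin n → D) :
    ip (∑ l, y l) (∑ l, y l) ≤ (n : ℝ) * ∑ l, ip (y l) (y l) := by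
  have hexp : ip (∑ i, y i) (∑ l, y l) = ∑ i, ∑ l, ip (y i) (y l) := by
    have h := bilin_sum_smul_sum_smul ip (fun _ => (1 : ℝ)) (fun _ => (1 : ℝ)) y y
    simp only [one_smul, one_mul] at h
    exact h
  rw [hexp]
  set f : Fin n → ℝ := fun l => ip (y l) (y l) with hf
  have h1 : ∑ i, ∑ l, ip (y i) (y l) ≤ ∑ i, ∑ l, (f i + f l) / 2 := by
    refine Finset.sum_le_sum fun i _ => Finset.sum_le_sum fun l _ => ?_
    have := two_mul_bilin_le ip hsymm hpos (y i) (y l)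
    simp only [hf]
    linarith
  have h2 : ∑ i : Fin n, ∑ l : Fin n, (f i + f l) / 2 = (n : ℝ) * ∑ l, f l := by
    have hin : ∀ i : Fin n, ∑ l : Fin n, (f i + f l) / 2 = ((n : ℝ) * f i + ∑ l, f l) / 2 := by
      intro i
      rw [← Finset.sum_div, Finset.sum_add_distrib, Finset.sum_const, Finset.card_univ, Fintype.card_fin,
        nsmul_eq_mul]
    rw [Finset.sum_congr rfl fun i _ => hin i, ← Finset.sum_div, Finset.sum_add_distrib, Finset.sum_const,
      Finset.card_univ, Fintype.card_fin, nsmul_eq_mul, ← Finset.mul_sum]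
    ring
  calc ∑ i, ∑ l, ip (y i) (y l) ≤ ∑ i, ∑ l, (f i + f l) / 2 := h1
    _ = (n : ℝ) * ∑ l, f l := h2

/-- **LEMMA A — residual Gram form of a Ritz basis from per-generator residuals.**  `ip` symmetric positive semidefinite, `K`
`ip`-symmetric; generators `v₀ … v_{n−1}` with Gram conditioning `g Σ b_l² ≤ ip(Σ b_l v_l, Σ b_l v_l)` (`g > 0`) and per-generator
residuals `ip((K − d_l)v_l, (K − d_l)v_l) ≤ ρ` (any scalars `d_l`); `u₀ … u_{k−1}` an `ip`-orthonormal `K`-diagonal family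
(`ip(u_i, K u_l) = m_i δ_il`) with `span u = span v`.  Then the residual Gram form of `u` obeys
`ip(Σ c_i (K u_i − m_i u_i), Σ c_i (K u_i − m_i u_i)) ≤ (n ρ / g) Σ c_i²`.
Proof: `r = Σ c_i (K u_i − m_i u_i) = Kψ − s` (`ψ = Σ c_i u_i`, `s ∈ span`) is `ip`-orthogonal to the span, so `ip(r,r) ≤ ip(Kψ − x, Kψ − x)`
for every `x` in the span (Pythagoras); with `ψ = Σ b_l v_l` take `x = Σ b_l d_l v_l`: `Kψ − x = Σ b_l (K − d_l) v_l` has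
`ip`-square `≤ n ρ Σ b_l² ≤ n ρ ip(ψ,ψ)/g = (nρ/g) Σ c_i²`. [cite: GolubVanLoan2013, §8.1.1] -/
theorem residualGram_le_of_generators (ip : D →ₗ[ℝ] D →ₗ[ℝ] ℝ)
    (hip_symm : ∀ x y, ip x y = ip y x) (hip_nonneg : ∀ x, 0 ≤ ip x x)
    (K : D →ₗ[ℝ] D) (hK : ∀ x y, ip (K x) y = ip x (K y))
    {n k : ℕ} (v : Fin n → D) (d : Fin n → ℝ) (u : Fin k → D) (m : Fin k → ℝ)
    (hon : ∀ i l, ip (u i) (u l) = if i = l then 1 else 0)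
    (hritz : ∀ i l, ip (u i) (K (u l)) = if i = l then m i else 0)
    (huv : ∀ i, u i ∈ Submodule.span ℝ (Set.range v))
    (hvu : ∀ l, v l ∈ Submodule.span ℝ (Set.range u))
    {g ρ : ℝ} (hg : 0 < g) (hρ : 0 ≤ ρ)
    (hgram : ∀ b : Fin n → ℝ, g * ∑ l, b l ^ 2 ≤ ip (∑ l, b l • v l) (∑ l, b l • v l))
    (hres : ∀ l, ip (K (v l) - d l • v l) (K (v l) - d l • v l) ≤ ρ)
    (c : Fin k → ℝ) :
    ip (∑ i, c i • (K (u i) - m i • u i)) (∑ i, c i • (K (u i) - m i • u i)) ≤ ((n : ℝ) * ρ / g) * ∑ i, c i ^ 2 := by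
  classical
  -- `ψ = Σ c_i u_i ∈ span v`; write `ψ = Σ b_l v_l`
  set ψ : D := ∑ i, c i • u i with hψ
  have hψv : ψ ∈ Submodule.span ℝ (Set.range v) :=
    Submodule.sum_mem _ fun i _ => Submodule.smul_mem _ _ (huv i)
  obtain ⟨b, hb⟩ := (Submodule.mem_span_range_iff_exists_fun ℝ).mp hψv
  -- the residual combination `r = Kψ − s`
  set r : D := ∑ i, c i • (K (u i) - m i • u i) with hr
  set s : D := ∑ i, (c i * m i) • u i with hs
  have hrψ : r = K ψ - s := by
    rw [hr, hψ, hs, map_sum, ← Finset.sum_sub_distrib]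
    refine Finset.sum_congr rfl fun i _ => ?_
    rw [map_smul, smul_sub, smul_smul]
  -- `r ⊥ u_l`, hence `r ⊥ span u`
  have hru : ∀ l, ip r (u l) = 0 := by
    intro l
    rw [hr, bilin_sum_smul_left]
    refine Finset.sum_eq_zero fun i _ => ?_
    have h0 : ip (K (u i) - m i • u i) (u l) = 0 := by
      simp only [map_sub, map_smul, LinearMap.sub_apply, LinearMap.smul_apply, smul_eq_mul]
      rw [hK, hritz, hon]
      split_ifs <;> ring
    rw [h0, mul_zero]
  have hrspan : ∀ w ∈ Submodule.span ℝ (Set.range u), ip r w = 0 := by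
    intro w hw
    have hle : Submodule.span ℝ (Set.range u) ≤ LinearMap.ker (ip r) := by
      refine Submodule.span_le.mpr ?_
      rintro _ ⟨l, rfl⟩
      exact LinearMap.mem_ker.mpr (hru l)
    exact LinearMap.mem_ker.mp (hle hw)
  -- the comparison vector `x = Σ b_l d_l v_l ∈ span u`, and `s ∈ span u`
  set x : D := ∑ l, (b l * d l) • v l with hx
  have hxu : x ∈ Submodule.span ℝ (Set.range u) :=
    Submodule.sum_mem _ fun l _ => Submodule.smul_mem _ _ (hvu l)
  have hsu : s ∈ Submodule.span ℝ (Set.range u) :=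
    Submodule.sum_mem _ fun i _ => Submodule.smul_mem _ _ (Submodule.subset_span (Set.mem_range_self i))
  -- Pythagoras: `ip r r ≤ ip (Kψ − x) (Kψ − x)`
  have hpyth : ip r r ≤ ip (K ψ - x) (K ψ - x) := by
    have hdec : K ψ - x = r + (s - x) := by rw [hrψ]; abel
    have h0 : ip r (s - x) = 0 := hrspan _ (Submodule.sub_mem _ hsu hxu)
    have h0' : ip (s - x) r = 0 := by rw [hip_symm]; exact h0
    rw [hdec]
    simp only [map_add, LinearMap.add_apply]
    rw [h0, h0']
    have := hip_nonneg (s - x)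
    linarith
  -- `Kψ − x = Σ b_l (K v_l − d_l v_l)`
  have hKψx : K ψ - x = ∑ l, b l • (K (v l) - d l • v l) := by
    rw [← hb, hx, map_sum, ← Finset.sum_sub_distrib]
    refine Finset.sum_congr rfl fun l _ => ?_
    rw [map_smul, smul_sub, smul_smul]
  have hsum : ip (K ψ - x) (K ψ - x) ≤ (n : ℝ) * (ρ * ∑ l, b l ^ 2) := by
    rw [hKψx]
    refine (bilin_sum_self_le ip hip_symm hip_nonneg _).trans ?_
    refine mul_le_mul_of_nonneg_left ?_ (Nat.cast_nonneg n)
    rw [Finset.mul_sum]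
    refine Finset.sum_le_sum fun l _ => ?_
    simp only [map_smul, LinearMap.smul_apply, smul_eq_mul]
    have h1 := hres l
    have hb2 : 0 ≤ b l * b l := mul_self_nonneg _
    nlinarith
  -- `g Σ b_l² ≤ ip ψ ψ = Σ c_i²`
  have hψψ : ip ψ ψ = ∑ i, c i ^ 2 := by
    rw [hψ, bilin_sum_smul_sum_smul]
    refine Finset.sum_congr rfl fun i _ => ?_
    simp only [hon, mul_ite, mul_one, mul_zero, Finset.sum_ite_eq, Finset.mem_univ, if_true]
    ring
  have hbsum : g * ∑ l, b l ^ 2 ≤ ∑ i, c i ^ 2 := by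
    rw [← hψψ, ← hb]
    exact hgram b
  have hb_le : ∑ l, b l ^ 2 ≤ (∑ i, c i ^ 2) / g := by
    rw [le_div_iff₀ hg]
    linarith
  calc ip r r ≤ (n : ℝ) * (ρ * ∑ l, b l ^ 2) := hpyth.trans hsum
    _ ≤ (n : ℝ) * (ρ * ((∑ i, c i ^ 2) / g)) :=
        mul_le_mul_of_nonneg_left (mul_le_mul_of_nonneg_left hb_le hρ) (Nat.cast_nonneg n)
    _ = ((n : ℝ) * ρ / g) * ∑ i, c i ^ 2 := by ring

end Generators

/-! ## §5  LEMMA B, arithmetic core — quadratic forms with near-diagonal data (index-generic, operator-free)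

For a coefficient vector `b`, "matrices" `A G : ι → ι → ℝ` with `|G_il − δ_il| ≤ ε` and SYMMETRISED couplings
`|A_il − ½(d_i + d_l) G_il| ≤ τ` (both for ALL `(i,l)`; on the diagonal they say `G_ii = 1`, `A_ii = d_i` up to the
tolerances), the quadratic form `Σ_i Σ_l b_i b_l (A_il − t G_il)` differs from its diagonal model `Σ_i (d_i − t) b_i²` by at
most `τ B² + ε B Σ_i |d_i − t| |b_i|`, `B = Σ|b_i|` (`quadForm_sub_diag_abs_le`).  Completing the square index by index
then gives a LOWER bound when all `d_i − t ≥ 0` and an UPPER bound when the coefficients at indices with `d_i − t > 0` are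
`≤ εB` (which is what `ip`-orthogonality constraints force) — both SECOND order in `ε`. -/

section LemmaBCore

variable {ι : Type*} [Fintype ι] [DecidableEq ι]

omit [DecidableEq ι] in
/-- Cauchy–Schwarz: `(Σ|b_i|)² ≤ card ι · Σ b_i²`. [folklore] -/
theorem sq_sum_abs_le_card_mul_sum_sq (b : ι → ℝ) :
    (∑ i, |b i|) ^ 2 ≤ (Fintype.card ι : ℝ) * ∑ i, b i ^ 2 := by
  have h := Finset.sum_mul_sq_le_sq_mul_sq (Finset.univ : Finset ι) (fun _ => (1 : ℝ)) (fun i => |b i|)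
  simpa only [one_mul, one_pow, Finset.sum_const, Finset.card_univ, nsmul_eq_mul, mul_one, sq_abs] using h

/-- **(★) diagonal approximation of a quadratic form with near-diagonal data.** [folklore] -/
theorem quadForm_sub_diag_abs_le (A G : ι → ι → ℝ) (d b : ι → ℝ) (t ε τ : ℝ)
    (hG : ∀ i l, |G i l - (if i = l then 1 else 0)| ≤ ε)
    (hS : ∀ i l, |A i l - (d i + d l) / 2 * G i l| ≤ τ) :
    |∑ i, ∑ l, b i * b l * (A i l - t * G i l) - ∑ i, (d i - t) * b i ^ 2|
      ≤ τ * (∑ i, |b i|) ^ 2 + ε * (∑ i, |b i|) * ∑ i, |d i - t| * |b i| := by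
  -- pointwise splitting of the summand
  have key : ∀ i l, b i * b l * (A i l - t * G i l)
      = (b i * b l * (A i l - (d i + d l) / 2 * G i l)
          + b i * b l * (((d i - t) + (d l - t)) / 2) * (G i l - (if i = l then 1 else 0)))
        + (if i = l then ((d i - t) + (d l - t)) / 2 * (b i * b l) else 0) := by
    intro i l; split_ifs <;> ring
  have hdiag : ∑ i, ∑ l, (if i = l then ((d i - t) + (d l - t)) / 2 * (b i * b l) else 0)
      = ∑ i, (d i - t) * b i ^ 2 := by
    refine Finset.sum_congr rfl fun i _ => ?_
    rw [Finset.sum_ite_eq]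
    simp only [Finset.mem_univ, if_true]
    ring
  have hrew : ∑ i, ∑ l, b i * b l * (A i l - t * G i l) - ∑ i, (d i - t) * b i ^ 2
      = ∑ i, ∑ l, (b i * b l * (A i l - (d i + d l) / 2 * G i l)
          + b i * b l * (((d i - t) + (d l - t)) / 2) * (G i l - (if i = l then 1 else 0))) := by
    rw [← hdiag, ← Finset.sum_sub_distrib]
    refine Finset.sum_congr rfl fun i _ => ?_
    rw [← Finset.sum_sub_distrib]
    refine Finset.sum_congr rfl fun l _ => ?_
    rw [key i l]; ring
  rw [hrew]
  -- termwise absolute values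
  have hterm : ∀ i l, |b i * b l * (A i l - (d i + d l) / 2 * G i l)
          + b i * b l * (((d i - t) + (d l - t)) / 2) * (G i l - (if i = l then 1 else 0))|
      ≤ τ * (|b i| * |b l|)
        + ((ε / 2) * ((|d i - t| * |b i|) * |b l|) + (ε / 2) * (|b i| * (|d l - t| * |b l|))) := by
    intro i l
    have hbb : 0 ≤ |b i| * |b l| := mul_nonneg (abs_nonneg _) (abs_nonneg _)
    have h1 : |b i * b l * (A i l - (d i + d l) / 2 * G i l)| ≤ τ * (|b i| * |b l|) := by
      rw [abs_mul, abs_mul]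
      calc |b i| * |b l| * |A i l - (d i + d l) / 2 * G i l| ≤ |b i| * |b l| * τ :=
            mul_le_mul_of_nonneg_left (hS i l) hbb
        _ = τ * (|b i| * |b l|) := by ring
    have ha : |((d i - t) + (d l - t)) / 2| ≤ (|d i - t| + |d l - t|) / 2 := by
      rw [abs_div, abs_two]
      exact div_le_div_of_nonneg_right (abs_add_le _ _) zero_le_two
    have h2 : |b i * b l * (((d i - t) + (d l - t)) / 2) * (G i l - (if i = l then 1 else 0))|
        ≤ (|b i| * |b l|) * ((|d i - t| + |d l - t|) / 2) * ε := by
      rw [abs_mul, abs_mul, abs_mul]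
      apply mul_le_mul _ (hG i l) (abs_nonneg _) (mul_nonneg hbb (by positivity))
      exact mul_le_mul_of_nonneg_left ha hbb
    calc _ ≤ |b i * b l * (A i l - (d i + d l) / 2 * G i l)|
            + |b i * b l * (((d i - t) + (d l - t)) / 2) * (G i l - (if i = l then 1 else 0))| := abs_add_le _ _
      _ ≤ τ * (|b i| * |b l|) + (|b i| * |b l|) * ((|d i - t| + |d l - t|) / 2) * ε := add_le_add h1 h2
      _ = _ := by ring
  -- sum up
  calc |∑ i, ∑ l, (b i * b l * (A i l - (d i + d l) / 2 * G i l)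
          + b i * b l * (((d i - t) + (d l - t)) / 2) * (G i l - (if i = l then 1 else 0)))|
      ≤ ∑ i, |∑ l, (b i * b l * (A i l - (d i + d l) / 2 * G i l)
          + b i * b l * (((d i - t) + (d l - t)) / 2) * (G i l - (if i = l then 1 else 0)))| :=
        Finset.abs_sum_le_sum_abs _ _
    _ ≤ ∑ i, ∑ l, (τ * (|b i| * |b l|)
        + ((ε / 2) * ((|d i - t| * |b i|) * |b l|) + (ε / 2) * (|b i| * (|d l - t| * |b l|)))) := by
        refine Finset.sum_le_sum fun i _ => (Finset.abs_sum_le_sum_abs _ _).trans ?_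
        exact Finset.sum_le_sum fun l _ => hterm i l
    _ = τ * (∑ i, |b i|) ^ 2 + ε * (∑ i, |b i|) * ∑ i, |d i - t| * |b i| := by
        simp only [Finset.sum_add_distrib, ← Finset.mul_sum, ← Finset.sum_mul]
        ring

/-- **LOWER bound** (all `d_i − t ≥ 0`): second order in `ε`. [folklore] -/
theorem quadForm_lower_of_nonneg (A G : ι → ι → ℝ) (d b : ι → ℝ) (t ε τ σ : ℝ)
    (hG : ∀ i l, |G i l - (if i = l then 1 else 0)| ≤ ε)
    (hS : ∀ i l, |A i l - (d i + d l) / 2 * G i l| ≤ τ)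
    (ha : ∀ i, 0 ≤ d i - t) (hσ : ∀ i, d i - t ≤ σ) :
    -((τ + ε ^ 2 * σ * (Fintype.card ι : ℝ) / 4) * (∑ i, |b i|) ^ 2)
      ≤ ∑ i, ∑ l, b i * b l * (A i l - t * G i l) := by
  have h := (abs_le.mp (quadForm_sub_diag_abs_le A G d b t ε τ hG hS)).1
  set B : ℝ := ∑ i, |b i| with hB
  have hB0 : 0 ≤ B := Finset.sum_nonneg fun i _ => abs_nonneg (b i)
  -- complete the square index by index
  have hi : ∀ i, -(σ * (ε ^ 2 * B ^ 2 / 4)) ≤ (d i - t) * b i ^ 2 - ε * B * (|d i - t| * |b i|) := by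
    intro i
    rw [abs_of_nonneg (ha i), ← sq_abs (b i)]
    have hsq : 0 ≤ (d i - t) * (|b i| - ε * B / 2) ^ 2 := mul_nonneg (ha i) (sq_nonneg _)
    have hq : 0 ≤ ε ^ 2 * B ^ 2 / 4 := by positivity
    nlinarith [hsq, mul_le_mul_of_nonneg_right (hσ i) hq]
  have hsum : -((Fintype.card ι : ℝ) * (σ * (ε ^ 2 * B ^ 2 / 4)))
      ≤ ∑ i, ((d i - t) * b i ^ 2 - ε * B * (|d i - t| * |b i|)) := by
    have := Finset.sum_le_sum fun i (_ : i ∈ Finset.univ) => hi i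
    rw [Finset.sum_const, Finset.card_univ, nsmul_eq_mul] at this
    linarith
  have hsplit : ∑ i, ((d i - t) * b i ^ 2 - ε * B * (|d i - t| * |b i|))
      = ∑ i, (d i - t) * b i ^ 2 - ε * B * ∑ i, |d i - t| * |b i| := by
    simp only [Finset.sum_sub_distrib, ← Finset.mul_sum]
  rw [hsplit] at hsum
  nlinarith [hsum, h]

/-- **UPPER bound** (coefficients at indices with `d_i − t > 0` are `≤ εB`): second order in `ε`. [folklore] -/
theorem quadForm_upper_of_constraints (A G : ι → ι → ℝ) (d b : ι → ℝ) (t ε τ σ : ℝ) (hε : 0 ≤ ε)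
    (hG : ∀ i l, |G i l - (if i = l then 1 else 0)| ≤ ε)
    (hS : ∀ i l, |A i l - (d i + d l) / 2 * G i l| ≤ τ)
    (hσ : ∀ i, |d i - t| ≤ σ)
    (hcons : ∀ i, 0 < d i - t → |b i| ≤ ε * ∑ l, |b l|) :
    ∑ i, ∑ l, b i * b l * (A i l - t * G i l)
      ≤ (τ + 2 * σ * ε ^ 2 * (Fintype.card ι : ℝ)) * (∑ i, |b i|) ^ 2 := by
  have h := (abs_le.mp (quadForm_sub_diag_abs_le A G d b t ε τ hG hS)).2
  set B : ℝ := ∑ i, |b i| with hB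
  have hB0 : 0 ≤ B := Finset.sum_nonneg fun i _ => abs_nonneg (b i)
  have hεB : 0 ≤ ε * B := mul_nonneg hε hB0
  have hi : ∀ i, (d i - t) * b i ^ 2 + ε * B * (|d i - t| * |b i|) ≤ 2 * σ * (ε ^ 2 * B ^ 2) := by
    intro i
    have hσi := hσ i
    have hσ0 : 0 ≤ σ := (abs_nonneg _).trans hσi
    rw [← sq_abs (b i)]
    rcases lt_or_ge 0 (d i - t) with hpos | hnp
    · -- constrained index: `|b_i| ≤ εB`
      have hb := hcons i hpos
      have hdi : d i - t ≤ σ := (le_abs_self _).trans hσi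
      rw [abs_of_pos hpos]
      have h1 : |b i| ^ 2 ≤ (ε * B) ^ 2 := pow_le_pow_left₀ (abs_nonneg _) hb 2
      have h2 : (d i - t) * |b i| ^ 2 ≤ σ * (ε * B) ^ 2 :=
        mul_le_mul hdi h1 (sq_nonneg _) hσ0
      have h3 : ε * B * ((d i - t) * |b i|) ≤ ε * B * (σ * (ε * B)) :=
        mul_le_mul_of_nonneg_left (mul_le_mul hdi hb (abs_nonneg _) hσ0) hεB
      nlinarith [h2, h3]
    · -- unconstrained index with `d_i − t ≤ 0`: complete the square
      rw [abs_of_nonpos hnp]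
      have hsq : 0 ≤ (t - d i) * (|b i| - ε * B / 2) ^ 2 := mul_nonneg (by linarith) (sq_nonneg _)
      have hdi : t - d i ≤ σ := by
        have := neg_abs_le (d i - t); linarith
      have hq : 0 ≤ ε ^ 2 * B ^ 2 / 4 := by positivity
      nlinarith [hsq, mul_le_mul_of_nonneg_right hdi hq, hσ0, hq]
  have hsum : ∑ i, ((d i - t) * b i ^ 2 + ε * B * (|d i - t| * |b i|))
      ≤ (Fintype.card ι : ℝ) * (2 * σ * (ε ^ 2 * B ^ 2)) := by
    have := Finset.sum_le_sum fun i (_ : i ∈ Finset.univ) => hi i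
    simpa only [Finset.sum_const, Finset.card_univ, nsmul_eq_mul] using this
  have hsplit : ∑ i, ((d i - t) * b i ^ 2 + ε * B * (|d i - t| * |b i|))
      = ∑ i, (d i - t) * b i ^ 2 + ε * B * ∑ i, |d i - t| * |b i| := by
    simp only [Finset.sum_add_distrib, ← Finset.mul_sum]
  rw [hsplit] at hsum
  nlinarith [hsum, h]

/-- Gram lower bound: `Σ_i Σ_l b_i b_l G_il ≥ (1 − card·ε) Σ b_i²`. [folklore] -/
theorem gram_lower (G : ι → ι → ℝ) (b : ι → ℝ) (ε : ℝ) (hε : 0 ≤ ε)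
    (hG : ∀ i l, |G i l - (if i = l then 1 else 0)| ≤ ε) :
    (1 - (Fintype.card ι : ℝ) * ε) * ∑ i, b i ^ 2 ≤ ∑ i, ∑ l, b i * b l * G i l := by
  have hsplit : ∑ i, ∑ l, b i * b l * G i l
      = ∑ i, b i ^ 2 + ∑ i, ∑ l, b i * b l * (G i l - (if i = l then 1 else 0)) := by
    rw [← Finset.sum_add_distrib]
    refine Finset.sum_congr rfl fun i _ => ?_
    have : ∑ l, b i * b l * (G i l - (if i = l then 1 else 0))
        = ∑ l, b i * b l * G i l - ∑ l, (if i = l then b i * b l else 0) := by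
      rw [← Finset.sum_sub_distrib]
      refine Finset.sum_congr rfl fun l _ => ?_
      split_ifs <;> ring
    rw [this, Finset.sum_ite_eq]
    simp only [Finset.mem_univ, if_true]
    ring
  have habs : |∑ i, ∑ l, b i * b l * (G i l - (if i = l then 1 else 0))| ≤ ε * (∑ i, |b i|) ^ 2 := by
    calc _ ≤ ∑ i, |∑ l, b i * b l * (G i l - (if i = l then 1 else 0))| := Finset.abs_sum_le_sum_abs _ _
      _ ≤ ∑ i, ∑ l, ε * (|b i| * |b l|) := by
          refine Finset.sum_le_sum fun i _ => (Finset.abs_sum_le_sum_abs _ _).trans ?_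
          refine Finset.sum_le_sum fun l _ => ?_
          rw [abs_mul, abs_mul]
          calc |b i| * |b l| * |G i l - (if i = l then 1 else 0)| ≤ |b i| * |b l| * ε :=
                mul_le_mul_of_nonneg_left (hG i l) (mul_nonneg (abs_nonneg _) (abs_nonneg _))
            _ = ε * (|b i| * |b l|) := by ring
      _ = ε * (∑ i, |b i|) ^ 2 := by
          simp only [← Finset.mul_sum, ← Finset.sum_mul]
          ring
  have hcs := sq_sum_abs_le_card_mul_sum_sq b
  have h1 := (abs_le.mp habs).1
  rw [hsplit]
  nlinarith [h1, hcs, mul_le_mul_of_nonneg_left hcs hε]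

/-- Constraint ⇒ small coefficient: if `Σ_l G_il b_l = 0` then `|b_i| ≤ ε Σ|b_l|`. [folklore] -/
theorem abs_coeff_le_of_constraint (G : ι → ι → ℝ) (b : ι → ℝ) (ε : ℝ)
    (hG : ∀ i l, |G i l - (if i = l then 1 else 0)| ≤ ε) (i : ι)
    (hcon : ∑ l, G i l * b l = 0) : |b i| ≤ ε * ∑ l, |b l| := by
  have hbi : b i = ∑ l, ((if i = l then 1 else 0) - G i l) * b l := by
    have : ∑ l, ((if i = l then 1 else 0) - G i l) * b l
        = ∑ l, (if i = l then b l else 0) - ∑ l, G i l * b l := by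
      rw [← Finset.sum_sub_distrib]
      refine Finset.sum_congr rfl fun l _ => ?_
      split_ifs <;> ring
    rw [this, hcon, sub_zero, Finset.sum_ite_eq]
    simp
  rw [hbi, Finset.mul_sum]
  refine (Finset.abs_sum_le_sum_abs _ _).trans (Finset.sum_le_sum fun l _ => ?_)
  rw [abs_mul, abs_sub_comm]
  exact mul_le_mul_of_nonneg_right (hG i l) (abs_nonneg _)

end LemmaBCore

end Summit.QuantumFields.YangMills.Theorems.FemtoTransferGap.KTGen

end
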